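import Literature.Analysis.FluidPDE.LerayHopfEventualRegularity
import Literature.Analysis.FluidPDE.FiniteEnergyClassicalL2Decay
import Literature.Analysis.FluidPDE.TaoBoundedEnstrophyLerayH1
import HarnessLib

/-!
# `L²` decay of global Leray–Hopf weak solutions on `ℝ³` (Masuda 1984; Leray's §34 question)

Leray (1934, §34) asked whether the kinetic energy `½∫|u(x,t)|² dx` of his turbulent (weak)
solutions of the unforced Navier–Stokes system on `ℝ³` tends to `0` as `t → ∞`. Masuda (1984,
Thm. 4 with Cor. 2 and the remark following it, pp. 628–629) and Kato (1984, §4) answered it in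
the affirmative. This file proves the statement for the tree's (strict) Leray–Hopf class: for
`ν > 0` and `u` Leray–Hopf on `ℝ³ × [0, T)` from `u₀` for every `T > 0`
(`IsLerayHopfOn T ν 0 u₀ u`, energy inequalities from `0` and from a.e. time included),
`∫ |u(t, x)|² dx → 0` as `t → ∞`
(`tendsto_lintegral_enorm_sq_atTop_of_isGlobalLerayHopf`, `tendsto_kineticEnergy_atTop_of_isGlobalLerayHopf`).
No rate is asserted (none holds uniformly on `L²` data).

## Proof (all inputs are tree theorems)

1. *Eventual regularity* (`exists_classical_Ioi_of_forall_isLerayHopfOn`, Leray 1934 §34 /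
   Robinson–Rodrigo–Sadowski 2016 Thm. 8.1, unconditional through `leray_local_regular_H1_holds`):
   there are `T* ≤ K(u₀)²/(cν⁵) + 1` and a classical solution `(v, p)` on the time set `(T*, ∞)`
   with `v(t) = u(t)` a.e. for every `t > T*`.
2. *A good restarting time beyond Leray's epoch*: a.e. `s` is a restarting time of the Leray–Hopf
   class simultaneously for countably many horizons (`IsLerayHopfOn.ae_isLerayHopfOn_restart`) with
   `u(s) ∈ H¹` (`ae_eH1NormSq_lt_top`); from such an `s > K(u₀)²/(cν⁵) + 1` the solution is
   `H¹`-regular on every `[s, T]` (`isH1RegularOn_Icc_of_good_time_of_lt`), so `‖u(t)‖²_{H¹}` is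
   bounded on compact time sets, and the smooth representative inherits
   `∫‖D¹v(t)‖² ≤ ‖u(t)‖²_{H¹}` (`lintegral_iteratedFDeriv_one_le_eH1NormSq`, `eH1NormSq_congr_ae`);
   its energy is `≤ 2K(u₀)` by the energy inequality (`IsLerayHopfOn.kineticEnergy_le_of_zero_force`).
3. *Tao's class*: an `H¹`-bounded finite-energy classical solution has all Sobolev norms bounded
   away from its initial time (`IsClassicalNSSolutionOn.hasBoundedSobolevNormsOn_of_h1Bounded`), so
   `t ↦ v(t + s + 1)` is a classical solution on every `[0, T]` in the class of the tree's decay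
   theorem for classical solutions (`EnergyDecay.tendsto_lintegral_enorm_sq_atTop_of_hasBoundedSobolevNormsOn`,
   Masuda/Kato for that class: heat low-pass of the Duhamel term through the energy, Ledoux's
   defect bound at times of small dissipation, monotonicity of the energy).
4. Transfer back to `u` along the a.e. equality of slices.

## Names used

`exists_classical_Ioi_of_forall_isLerayHopfOn`, `isH1RegularOn_Icc_of_good_time_of_lt`
(`LerayHopfEventualRegularity`); `leray_local_regular_H1_holds`, `leray_local_strong_H1_of_regular`
(`LerayLocalRegularH1(Proofs)`); `IsLerayHopfOn.ae_isLerayHopfOn_restart` (`LerayHopfRestart`);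
`IsLerayHopfOn.exists_measurable_weakGradient`, `ae_eH1NormSq_lt_top`, `eH1NormSq_congr_ae`,
`exists_mem_Ioo_of_ae_restrict_Ioo`, `IsH1RegularOn.exists_forall_le` (`LerayH1Continuation`,
`CheskidovShvydkoyRegular`); `lintegral_iteratedFDeriv_one_le_eH1NormSq`
(`TaoBoundedEnstrophyLerayH1`); `IsClassicalNSSolutionOn.hasBoundedSobolevNormsOn_of_h1Bounded`
(`NSH1BoundedSmoothing`); `IsClassicalNSSolutionOn.comp_add_right/mono/contDiff_velocity`;
`IsLerayHopfOn.kineticEnergy_le_of_zero_force`, `IsLerayHopfOn.memLp`, `eEnergy_eq_ofReal`;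
`EnergyDecay.tendsto_lintegral_enorm_sq_atTop_of_hasBoundedSobolevNormsOn`
(`FiniteEnergyClassicalL2Decay`).

## References

* K. Masuda, *Weak solutions of Navier–Stokes equations*, Tôhoku Math. J. 36 (1984) 623–646:
  Thm. 4 (p. 628: for `T = ∞` and a weak solution with `∫₀^∞‖∇u‖² dt < ∞`,
  `‖(I + A)^{-α}u(t)‖ → 0`), Cor. 2 (p. 629: if `‖u(t)‖` tends to a constant `c` then `c = 0`) and
  the remark after Cor. 2 (p. 629: Leray's weak solutions on `ℝ³` have `‖u(t)‖` monotonically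
  decreasing for large `t`, "hence tends to zero as `t → ∞`" — the affirmative answer to Leray's
  question). [Masuda1984]
* T. Kato, *Strong `Lᵖ`-solutions of the Navier–Stokes equation in `ℝᵐ`, with applications to weak
  solutions*, Math. Z. 187 (1984) 471–480, §4. [Kato1984]
* J. Leray, *Sur le mouvement d'un liquide visqueux emplissant l'espace*, Acta Math. 63 (1934),
  §34 (the question, p. 248). [Leray1934]
* J. C. Robinson, J. L. Rodrigo, W. Sadowski, *The Three-Dimensional Navier–Stokes Equations*,
  CUP 2016, Thm. 8.1 (eventual regularity). [RobinsonRodrigoSadowski2016]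
-/

noncomputable section

open MeasureTheory Set Function Filter
open _root_.Topology
open scoped ENNReal NNReal

namespace Literature.Analysis.FluidPDE

section Decay

variable {ν : ℝ} {u₀ : EuclideanSpace ℝ (Fin 3) → EuclideanSpace ℝ (Fin 3)}
  {u : ℝ → EuclideanSpace ℝ (Fin 3) → EuclideanSpace ℝ (Fin 3)}

/-- **Masuda's theorem — `L²` decay of global Leray–Hopf weak solutions on `ℝ³`** (Masuda 1984,
Thm. 4 with Cor. 2 and the following remark, pp. 628–629; Kato 1984, §4; the question of Leray
1934, §34). Let `ν > 0` and let `u` be a Leray–Hopf weak solution of the unforced Navier–Stokes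
system on `ℝ³ × [0, T)` from `u₀` for every `T > 0` (strict sense: energy inequalities from `0`
and from almost every time). Then `∫ |u(t, x)|² dx → 0` as `t → ∞`.

Proof: Leray's eventual regularity gives a classical representative `v` on `(T*, ∞)`; from a good
restarting time `s > T*` beyond Leray's epoch the solution is `H¹`-regular on every `[s, T]`, so
`v` is an `H¹`-bounded finite-energy classical solution on `[s, T]`, hence in Tao's class on
`[s + 1, T]`, where the tree's decay theorem for classical solutions applies; the conclusion
transfers to `u` along `v(t) = u(t)` a.e. No decay rate is asserted. [cite: Masuda1984, Thm. 4, Cor. 2 and Remark (pp. 628–629)] [cite: Kato1984, §4] [cite: Leray1934, §34] -/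
theorem tendsto_lintegral_enorm_sq_atTop_of_isGlobalLerayHopf (hν : 0 < ν)
    (hLH : ∀ T : ℝ, 0 < T → IsLerayHopfOn T ν 0 u₀ u) :
    Tendsto (fun t : ℝ => ∫⁻ x, ‖u t x‖ₑ ^ 2) atTop (𝓝 0) := by
  -- Leray's local `H¹` theory (a tree theorem) and eventual regularity
  obtain ⟨c, hc, hloc⟩ := leray_local_strong_H1_of_regular leray_local_regular_H1_holds
  obtain ⟨Tstar, v, p, -, hTle, hvp, hae⟩ :=
    exists_classical_Ioi_of_forall_isLerayHopfOn hc hloc hν hLH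
  set K : ℝ := VectorCalculus.kineticEnergy u₀ with hKdef
  set T₁ : ℝ := K ^ 2 / (c * ν ^ 5) + 1 with hT₁def
  have hT₀ : 0 ≤ K ^ 2 / (c * ν ^ 5) := by positivity
  have hT₁ : 0 ≤ T₁ := by positivity
  -- horizons `T_n ↑ ∞`
  set Tn : ℕ → ℝ := fun n => T₁ + n + 3 with hTndef
  have hTn2 : ∀ n, T₁ + 2 < Tn n := fun n => by
    simp only [hTndef]; linarith [n.cast_nonneg (α := ℝ)]
  have hTnpos : ∀ n, 0 < Tn n := fun n => by linarith [hTn2 n]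
  have hTn_exhaust : ∀ t : ℝ, ∃ n : ℕ, t < Tn n := by
    intro t
    obtain ⟨n, hn⟩ := exists_nat_gt (t - T₁ - 3)
    exact ⟨n, by simp only [hTndef]; linarith⟩
  -- good restarting times, simultaneously for all horizons, a.e. in `(0, T₁ + 2)`
  have hsub : ∀ n, Ioo 0 (T₁ + 2) ⊆ Ioo 0 (Tn n) := fun n => Ioo_subset_Ioo le_rfl (hTn2 n).le
  have hgood : ∀ᵐ s ∂(volume.restrict (Ioo 0 (T₁ + 2))),
      (∀ n : ℕ, IsLerayHopfOn (Tn n - s) ν 0 (u s) (fun t => u (t + s))) ∧ eH1NormSq (u s) < ∞ := by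
    have h1 : ∀ n : ℕ, ∀ᵐ s ∂(volume.restrict (Ioo 0 (T₁ + 2))),
        IsLerayHopfOn (Tn n - s) ν 0 (u s) (fun t => u (t + s)) := fun n =>
      ae_restrict_of_ae_restrict_of_subset (hsub n)
        ((hLH (Tn n) (hTnpos n)).ae_isLerayHopfOn_restart hν.le)
    have h2 : ∀ᵐ s ∂(volume.restrict (Ioo 0 (T₁ + 2))), eH1NormSq (u s) < ∞ := by
      obtain ⟨G, hGm, hG, hGint, -⟩ := (hLH (Tn 0) (hTnpos 0)).exists_measurable_weakGradient
      exact ae_restrict_of_ae_restrict_of_subset (hsub 0)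
        (ae_eH1NormSq_lt_top (hLH (Tn 0) (hTnpos 0)).memLp hGm hG hGint)
    filter_upwards [ae_all_iff.2 h1, h2] with s hs1 hs2
    exact ⟨hs1, hs2⟩
  obtain ⟨s, hs, hLHs, hfin⟩ :=
    exists_mem_Ioo_of_ae_restrict_Ioo (P := fun s =>
      (∀ n : ℕ, IsLerayHopfOn (Tn n - s) ν 0 (u s) (fun t => u (t + s))) ∧ eH1NormSq (u s) < ∞)
      hT₁ (by linarith : T₁ < T₁ + 1) (by linarith : T₁ + 1 ≤ T₁ + 2) hgood
  have hs0 : 0 < s := hT₁.trans_lt hs.1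
  have hsK : VectorCalculus.kineticEnergy u₀ ^ 2 / (c * ν ^ 5) < s := by
    rw [← hKdef]; linarith [hs.1]
  have hsT : Tstar < s := hTle.trans_lt hs.1
  -- `H¹`-regularity on `[s, T_n]` for every horizon
  have hreg : ∀ n, IsH1RegularOn (Icc s (Tn n)) u := fun n =>
    isH1RegularOn_Icc_of_good_time_of_lt hc hloc hν (hLH (Tn n) (hTnpos n))
      ⟨hs0, by linarith [hs.2, hTn2 n]⟩ hsK (hLHs n) hfin
  -- energy bound for the representative after `s`
  have hEv : ∀ t : ℝ, s ≤ t → ∫⁻ x, ‖v t x‖ₑ ^ 2 ≤ ENNReal.ofReal (2 * K) := by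
    intro t hst
    have htT : t ∈ Ioi Tstar := hsT.trans_le hst
    have ht0 : 0 ≤ t := hs0.le.trans hst
    have hLHt := hLH (t + 1) (by linarith)
    have htI : t ∈ Icc (0 : ℝ) (t + 1) := ⟨ht0, by linarith⟩
    have hmem : MemLp (u t) 2 volume := hLHt.memLp t htI
    -- energy inequality from `0` (zero force): `K(u t) ≤ K(u₀)`
    have hkin : VectorCalculus.kineticEnergy (u t) ≤ K := by
      obtain ⟨G, -, -, hEG, -⟩ := hLHt.weakGrad_energy
      have h := hEG t htI
      have hforce : ∫ τ in (0 : ℝ)..t, ∫ x,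
          inner ℝ ((0 : ℝ → EuclideanSpace ℝ (Fin 3) → EuclideanSpace ℝ (Fin 3)) τ x) (u τ x) = 0 := by
        simp
      rw [hforce, add_zero] at h
      have hD : 0 ≤ ν * (∫⁻ τ in Ioo 0 t, ∫⁻ x, ENNReal.ofReal (frobeniusNormSq (G τ x))).toReal :=
        mul_nonneg hν.le ENNReal.toReal_nonneg
      rw [hKdef]; linarith
    calc ∫⁻ x, ‖v t x‖ₑ ^ 2 = ∫⁻ x, ‖u t x‖ₑ ^ 2 :=
          lintegral_congr_ae ((hae t htT).mono fun x hx => by simp only [hx])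
      _ = eEnergy (u t) := rfl
      _ = ENNReal.ofReal (2 * VectorCalculus.kineticEnergy (u t)) := eEnergy_eq_ofReal _ hmem
      _ ≤ ENNReal.ofReal (2 * K) := ENNReal.ofReal_le_ofReal (by linarith)
  -- `H¹` bound for the representative on `[s, s + L]`
  have hHv : ∀ L : ℝ, 0 < L → ∃ C : ℝ≥0, ∀ t ∈ Icc s (s + L),
      ∫⁻ x, ‖iteratedFDeriv ℝ 1 (v t) x‖ₑ ^ 2 ≤ C := by
    intro L hL
    obtain ⟨n, hn⟩ := hTn_exhaust (s + L)
    obtain ⟨M, hMtop, hM⟩ :=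
      (hreg n).exists_forall_le isCompact_Icc (Icc_subset_Icc_right hn.le)
    refine ⟨M.toNNReal, fun t ht => ?_⟩
    have htT : t ∈ Ioi Tstar := hsT.trans_le ht.1
    have hcd : ContDiff ℝ 1 (v t) := (hvp.contDiff_velocity htT).of_le (by norm_cast)
    calc ∫⁻ x, ‖iteratedFDeriv ℝ 1 (v t) x‖ₑ ^ 2 ≤ eH1NormSq (v t) :=
          lintegral_iteratedFDeriv_one_le_eH1NormSq hcd
      _ = eH1NormSq (u t) := eH1NormSq_congr_ae (hae t htT)
      _ ≤ M := hM t ht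
      _ = (M.toNNReal : ℝ≥0∞) := (ENNReal.coe_toNNReal hMtop.ne).symm
  -- the representative translated to start at `s + b`, `b ≥ 0`, is classical on every `[0, T]`
  have hcl : ∀ b : ℝ, 0 ≤ b → ∀ T : ℝ, 0 < T →
      IsClassicalNSSolutionOn (Icc 0 T) ν 0 (fun t => v (t + (s + b))) (fun t => p (t + (s + b))) := by
    intro b hb T hT
    have h := hvp.comp_add_right (s + b)
    have h0 : (fun t => (0 : ℝ → EuclideanSpace ℝ (Fin 3) → EuclideanSpace ℝ (Fin 3)) (t + (s + b))) = 0 := rfl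
    rw [h0] at h
    refine h.mono (fun t ht => ?_) (uniqueDiffOn_Icc hT)
    simp only [mem_preimage, mem_Ioi]
    linarith [ht.1]
  -- Tao's class for the representative translated to start at `s + 1`
  have hB : ∀ T : ℝ, 0 < T → HasBoundedSobolevNormsOn (Icc 0 T) (fun t => v (t + (s + 1))) := by
    intro T hT
    have hcl0 : IsClassicalNSSolutionOn (Icc 0 (T + 1)) ν 0 (fun t => v (t + (s + 0)))
        (fun t => p (t + (s + 0))) := hcl 0 le_rfl (T + 1) (by linarith)
    simp only [add_zero] at hcl0
    have hE0 : ∃ C : ℝ≥0, ∀ t ∈ Icc 0 (T + 1), ∫⁻ x, ‖v (t + s) x‖ₑ ^ 2 ≤ C := by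
      refine ⟨(ENNReal.ofReal (2 * K)).toNNReal, fun t ht => (hEv (t + s) (by linarith [ht.1])).trans ?_⟩
      exact (ENNReal.coe_toNNReal ENNReal.ofReal_ne_top).ge
    have hH0 : ∃ C : ℝ≥0, ∀ t ∈ Icc 0 (T + 1),
        ∫⁻ x, ‖iteratedFDeriv ℝ 1 (v (t + s)) x‖ₑ ^ 2 ≤ C := by
      obtain ⟨C, hC⟩ := hHv (T + 1) (by linarith)
      exact ⟨C, fun t ht => hC (t + s) ⟨by linarith [ht.1], by linarith [ht.2]⟩⟩
    have hB0 : HasBoundedSobolevNormsOn (Icc 1 (T + 1)) (fun t => v (t + s)) :=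
      hcl0.hasBoundedSobolevNormsOn_of_h1Bounded hν (by linarith) hE0 hH0 one_pos (by linarith)
    intro n
    obtain ⟨C, hC⟩ := hB0 n
    refine ⟨C, fun t ht => ?_⟩
    have h := hC (t + 1) ⟨by linarith [ht.1], by linarith [ht.2]⟩
    have e : t + 1 + s = t + (s + 1) := by ring
    simpa only [e] using h
  -- bounded energy on `[0, ∞)` for the translate
  have hE : ∃ C : ℝ≥0∞, C < ⊤ ∧ ∀ t : ℝ, 0 ≤ t → ∫⁻ x, ‖v (t + (s + 1)) x‖ₑ ^ 2 ≤ C :=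
    ⟨ENNReal.ofReal (2 * K), ENNReal.ofReal_lt_top, fun t ht => hEv (t + (s + 1)) (by linarith)⟩
  -- decay of the translate (the tree's theorem for Tao-class finite-energy classical solutions)
  have hw := EnergyDecay.tendsto_lintegral_enorm_sq_atTop_of_hasBoundedSobolevNormsOn hν
    (hcl 1 zero_le_one) hB hE
  -- transfer to `u`
  have hshift : Tendsto (fun t : ℝ => t + -(s + 1)) atTop atTop :=
    tendsto_atTop_add_const_right _ _ tendsto_id
  refine (hw.comp hshift).congr' ?_
  filter_upwards [eventually_gt_atTop (s + 1)] with t ht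
  have htT : t ∈ Ioi Tstar := by
    simp only [mem_Ioi]; linarith
  simp only [Function.comp_def, neg_add_cancel_right]
  exact lintegral_congr_ae ((hae t htT).mono fun x hx => by simp only [hx])

/-- **Leray's question answered (Masuda 1984 / Kato 1984), kinetic-energy form**: for `ν > 0` and
`u` Leray–Hopf on `ℝ³ × [0, T)` from `u₀` for every `T > 0`, the kinetic energy
`½∫|u(t, x)|² dx` tends to `0` as `t → ∞`. [cite: Masuda1984, Thm. 4, Cor. 2 and Remark (pp. 628–629)] [cite: Leray1934, §34] -/
theorem tendsto_kineticEnergy_atTop_of_isGlobalLerayHopf (hν : 0 < ν)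
    (hLH : ∀ T : ℝ, 0 < T → IsLerayHopfOn T ν 0 u₀ u) :
    Tendsto (fun t : ℝ => VectorCalculus.kineticEnergy (u t)) atTop (𝓝 0) := by
  have h := tendsto_lintegral_enorm_sq_atTop_of_isGlobalLerayHopf hν hLH
  have h2 : Tendsto (fun t : ℝ => (∫⁻ x, ‖u t x‖ₑ ^ 2).toReal / 2) atTop (𝓝 0) := by
    have h3 := ((ENNReal.tendsto_toReal ENNReal.zero_ne_top).comp h).div_const 2
    simpa using h3
  refine h2.congr' ?_
  filter_upwards [eventually_ge_atTop 0] with t ht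
  have hmem : MemLp (u t) 2 volume := (hLH (t + 1) (by linarith)).memLp t ⟨ht, by linarith⟩
  have hnn := kineticEnergy_nonneg (u t)
  rw [show (∫⁻ x, ‖u t x‖ₑ ^ 2) = eEnergy (u t) from rfl, eEnergy_eq_ofReal _ hmem,
    ENNReal.toReal_ofReal (by linarith)]
  ring

/-- **Leray's question answered, real-integral form**: `∫ |u(t, x)|² dx → 0` as `t → ∞` for global
Leray–Hopf weak solutions on `ℝ³` (`ν > 0`). [cite: Masuda1984, Thm. 4, Cor. 2 and Remark (pp. 628–629)] [cite: Kato1984, §4] -/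
theorem tendsto_integral_norm_sq_atTop_of_isGlobalLerayHopf (hν : 0 < ν)
    (hLH : ∀ T : ℝ, 0 < T → IsLerayHopfOn T ν 0 u₀ u) :
    Tendsto (fun t : ℝ => ∫ x, ‖u t x‖ ^ 2) atTop (𝓝 0) := by
  have h := (tendsto_kineticEnergy_atTop_of_isGlobalLerayHopf hν hLH).const_mul 2
  rw [mul_zero] at h
  refine h.congr' (Eventually.of_forall fun t => ?_)
  simp only [VectorCalculus.kineticEnergy]
  ring

/-- **Masuda's theorem in the tree's `IsGlobalLerayHopf` vocabulary**: a global Leray–Hopf weak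
solution of the unforced system on `ℝ³` (`ν > 0`) has `∫ |u(t)|² → 0`. [cite: Masuda1984, Thm. 4, Cor. 2 and Remark (pp. 628–629)] -/
theorem IsGlobalLerayHopf.tendsto_lintegral_enorm_sq_atTop (hν : 0 < ν)
    (h : IsGlobalLerayHopf ν 0 u₀ u) :
    Tendsto (fun t : ℝ => ∫⁻ x, ‖u t x‖ₑ ^ 2) atTop (𝓝 0) :=
  tendsto_lintegral_enorm_sq_atTop_of_isGlobalLerayHopf hν fun T hT => h T hT

/-- **Masuda's theorem in the tree's `IsGlobalLerayHopf` vocabulary, kinetic-energy form.** [cite: Masuda1984, Thm. 4, Cor. 2 and Remark (pp. 628–629)] -/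
theorem IsGlobalLerayHopf.tendsto_kineticEnergy_atTop (hν : 0 < ν)
    (h : IsGlobalLerayHopf ν 0 u₀ u) :
    Tendsto (fun t : ℝ => VectorCalculus.kineticEnergy (u t)) atTop (𝓝 0) :=
  tendsto_kineticEnergy_atTop_of_isGlobalLerayHopf hν fun T hT => h T hT

end Decay

end Literature.Analysis.FluidPDE

end
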